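import Mathlib.Analysis.MeanInequalities
import Mathlib.Analysis.SpecialFunctions.Integrability.Basic
import Mathlib.MeasureTheory.Integral.ExpDecay
import Literature.NumberTheory.LFunctions.VonMangoldtLaplace
import Literature.NumberTheory.LFunctions.MertensBoundRH
import Literature.Analysis.Complex.HolomorphicParametricIntegral
import HarnessLib

/-!
# RH-EQUIVALENT · Verjovsky's Laplace `L^p` criterion: `RH ⟺ Φ ∈ L^p(0,∞)` for every `1 ≤ p < 2`, `Φ(t) = Σ μ(n) e^{−nt}` — PROVED; nothing here bears on the truth of RH

A. Verjovsky, *How Random Is the Möbius Function? Smoothing, Probability, and the Riemann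
Hypothesis*, arXiv:2607.25002 (v2, 14 Aug 2026), §§2–3. With the exponentially smoothed Möbius
sum (the *discrete Laplace transform* of `μ`)

  `Φ(t) = Σ_{n ≥ 1} μ(n) e^{−nt}`  (`t > 0`; eq. (2)),

the paper proves:

* **Prop. 2.1** (`Verjovsky2026_prop_2_1`): for `Re s > 1`, `∫₀^∞ Φ(t) t^{s−1} dt = Γ(s)/ζ(s)` (5).
* **Prop. 2.2** (`Verjovsky2026_prop_2_2`): for `1 < p < ∞`, if `Φ ∈ L^p(0,∞)` then `ζ(s) ≠ 0`
  throughout `Re s > 1/p` (Hölder gives absolute convergence of the Mellin integral for `σ > 1/p`,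
  holomorphy there, and `Γ` has no zeros) — also printed as Remark 3.3.
* **Thm. 3.1** (`Verjovsky2026_thm_3_1`, `Verjovsky2026_thm_3_1_iii`): the following are equivalent:
  (i) RH; (ii) `Φ ∈ L^p(0,∞)` for every `1 ≤ p < 2`; (iii) `Φ ∈ L^{2−ε}(0,∞)` for every
  `0 < ε ≤ 1`. "(i) ⟹ (ii)": Littlewood's `M(x) = O(x^{1/2+δ})` under RH, Abel summation
  `Φ(t) = (1 − e^{−t}) Σ M(n) e^{−nt}` (the series form of (6)), whence `|Φ(t)| ≪ t^{−1/2−δ}` on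
  `(0,1]`, plus exponential decay at infinity; "(ii) ⟹ (i)": Prop. 2.2 with `p ↑ 2` and the
  symmetry of the zeros.

Everything is PROVED, following the printed proofs; `Φ ∈ L^p(0,∞)` is Mathlib's
`MemLp Φ p (volume.restrict (Ioi 0))` (equivalently `∫₀^∞ |Φ|^p < ∞`, `memLp_moebiusLaplace_iff`).
Tree inputs: the Laplace-series toolkit of `LaplaceSeriesAbelian.lean` / `VonMangoldtLaplace.lean`
(`mellin_laplaceSeries` = termwise Euler integrals, Cauchy products, the weighted geometric series
`Σ (n+1)^α e^{−tn} ≤ K(α) t^{−α−1}`), Littlewood's theorem `mertensFunction_isBigO_of_riemannHypothesis`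
(`MertensBoundRH.lean`), the slit half-plane of `VonKochConverse.lean` for the identity-theorem
step, and the dominated holomorphic parameter integral of
`Literature/Analysis/Complex/HolomorphicParametricIntegral.lean` for "the Mellin transform is
holomorphic in its strip of absolute convergence" (`MoebiusLaplace.differentiableOn_mellin_of_integrableOn`,
stated for a general `f`, which Mathlib has only under pointwise `O`-bounds).

Remark 3.2 of the paper (no endpoint statement at `p = 2` is asserted) is respected: nothing is
claimed about `Φ ∈ L²`. The local Fourier-moment criterion (Thm. 4.1) and §§5–8 (random models,
measure/category) are not formalised here.

Labels: RH-EQUIVALENT literature (proved `↔`; neither side asserted); Props. 2.1/2.2 are RH-FREE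
theorems. No definitions beyond `moebiusLaplace`; no named facts. Nothing here bears on the truth
of RH.

## References

* A. Verjovsky, *How Random Is the Möbius Function? Smoothing, Probability, and the Riemann
  Hypothesis*, arXiv:2607.25002 (2026), §2 Prop. 2.1 (5), Prop. 2.2; §3 Thm. 3.1, (6), Remarks
  3.2–3.3. [Verjovsky2026]
* E. C. Titchmarsh, *The Theory of the Riemann Zeta-Function*, 2nd ed. (1986), Thm. 14.25
  (Littlewood's `M(x) = O(x^{1/2+ε})`). [Titchmarsh1986]
-/

noncomputable section

open Filter Asymptotics MeasureTheory Set Real Finset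
open scoped Topology ArithmeticFunction.Moebius

namespace Literature.NumberTheory.LFunctions

/-- Verjovsky's exponentially smoothed Möbius sum, the discrete Laplace transform
`Φ(t) = Σ_{n ≥ 1} μ(n) e^{−nt}` of the Möbius function (as the tree's `laplaceSeries` of
`n ↦ μ(n)`; the `n = 0` term vanishes since `μ(0) = 0`). [cite: Verjovsky2026, §1 eq. (2)] -/
def moebiusLaplace (t : ℝ) : ℝ :=
  laplaceSeries (fun n ↦ (μ n : ℝ)) t

namespace MoebiusLaplace

/-! ## §1 The series: unfolding, coefficient bounds, continuity, decay at infinity -/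

/-- Unfolding: `Φ(t) = Σ' n, μ(n) e^{−tn}`. [cite: Verjovsky2026, §1 eq. (2)] -/
theorem moebiusLaplace_eq_tsum (t : ℝ) :
    moebiusLaplace t = ∑' n : ℕ, (μ n : ℝ) * exp (-t * n) := by
  rw [moebiusLaplace, laplaceSeries_def]

/-- `|μ(n)| ≤ 1` over `ℝ`. [folklore] -/
private theorem abs_moebius_real_le_one (n : ℕ) : |((μ n : ℤ) : ℝ)| ≤ 1 := by
  exact_mod_cast ArithmeticFunction.abs_moebius_le_one

/-- `|μ(n)| ≤ n + 1` (the coefficient bound consumed by the Laplace-series toolkit). [folklore] -/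
private theorem abs_moebius_real_le_succ (n : ℕ) : |((μ n : ℤ) : ℝ)| ≤ (n : ℝ) + 1 :=
  (abs_moebius_real_le_one n).trans (by linarith [(n.cast_nonneg : (0 : ℝ) ≤ n)])

/-- `|μ(n)| ≤ 1 · (n+1)^0`. [folklore] -/
private theorem abs_moebius_real_le_one_mul (n : ℕ) : |((μ n : ℤ) : ℝ)| ≤ 1 * ((n : ℝ) + 1) ^ 0 := by
  simpa using abs_moebius_real_le_one n

/-- `μ(0) = 0` over `ℝ`. [folklore] -/
private theorem moebius_zero_real : ((μ 0 : ℤ) : ℝ) = 0 := by simp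

/-- `Φ` is continuous on `(0, ∞)`. [cite: Verjovsky2026, §2 (Φ is a convergent Dirichlet-type series for t > 0)] -/
theorem continuousOn_moebiusLaplace : ContinuousOn moebiusLaplace (Ioi 0) :=
  continuousOn_laplaceSeries abs_moebius_real_le_succ

/-- `Φ` is a.e. strongly measurable on `(0, ∞)` (real-valued form; it is continuous there).
[cite: Verjovsky2026, §2 eq. (2) (Φ as a function on (0,∞))] -/
theorem aestronglyMeasurable_moebiusLaplace :
    AEStronglyMeasurable moebiusLaplace (volume.restrict (Ioi 0)) :=
  continuousOn_moebiusLaplace.aestronglyMeasurable measurableSet_Ioi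

/-- `Φ` is a.e. strongly measurable on `(0, ∞)` (complex-valued form).
[cite: Verjovsky2026, §2 eq. (2) (Φ as a function on (0,∞))] -/
theorem aestronglyMeasurable_moebiusLaplace_complex :
    AEStronglyMeasurable (fun t ↦ ((moebiusLaplace t : ℝ) : ℂ)) (volume.restrict (Ioi 0)) :=
  (Complex.continuous_ofReal.comp_continuousOn continuousOn_moebiusLaplace).aestronglyMeasurable
    measurableSet_Ioi

/-- Exponential decay at infinity: `|Φ(t)| ≤ C e^{−t}` for `t ≥ 1`, with `C ≥ 0` (the paper's
"elementary estimate `|Φ(t)| ≤ Σ e^{−nt} = e^{−t}/(1 − e^{−t})`, `t ≥ 1`").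
[cite: Verjovsky2026, Prop. 2.2 proof (estimate at infinity)] -/
theorem exists_abs_moebiusLaplace_le_exp_neg :
    ∃ C : ℝ, 0 ≤ C ∧ ∀ t : ℝ, 1 ≤ t → |moebiusLaplace t| ≤ C * exp (-t) := by
  obtain ⟨C, hC⟩ := exists_abs_laplaceSeries_le_exp_neg moebius_zero_real abs_moebius_real_le_succ
  refine ⟨C, ?_, fun t ht ↦ hC t ht⟩
  have h1 := (abs_nonneg _).trans (hC 1 le_rfl)
  exact nonneg_of_mul_nonneg_left h1 (exp_pos _)

/-! ## §2 Proposition 2.1: `∫₀^∞ Φ(t) t^{s−1} dt = Γ(s)/ζ(s)` for `Re s > 1` -/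

/-- The `L`-series of `μ` with real-then-complex casts is `1/ζ(s)` for `Re s > 1`
(Mathlib `LSeries_zeta_mul_Lseries_moebius`; the last line of the proof of Prop. 2.1).
[cite: Verjovsky2026, Prop. 2.1 proof (Σ μ(n) n^{−s} = 1/ζ(s))] -/
theorem LSeries_moebius_real_eq {s : ℂ} (hs : 1 < s.re) :
    LSeries (fun n ↦ (((μ n : ℤ) : ℝ) : ℂ)) s = 1 / riemannZeta s := by
  have h1 := ArithmeticFunction.LSeries_zeta_mul_Lseries_moebius hs
  rw [ArithmeticFunction.LSeries_zeta_eq_riemannZeta hs] at h1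
  have hζ : riemannZeta s ≠ 0 := riemannZeta_ne_zero_of_one_lt_re hs
  have : (fun n ↦ (((μ n : ℤ) : ℝ) : ℂ)) = fun n ↦ ((μ n : ℤ) : ℂ) := by
    funext n; simp only [Complex.ofReal_intCast]
  rw [this, eq_div_iff hζ, mul_comm]
  exact h1

end MoebiusLaplace

open MoebiusLaplace

/-- **Verjovsky, Prop. 2.1** (Mellin transform of the discrete Laplace sum): for `Re s > 1`,
`MΦ(s) = ∫₀^∞ Φ(t) t^{s−1} dt = Γ(s)/ζ(s)` (termwise `∫₀^∞ e^{−nt} t^{s−1} dt = Γ(s) n^{−s}`,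
interchange by Tonelli since `Σ |μ(n)| ∫ e^{−nt} t^{σ−1} dt ≤ Γ(σ) Σ n^{−σ} < ∞`, then
`Σ μ(n) n^{−s} = 1/ζ(s)`). RH-FREE. [cite: Verjovsky2026, Prop. 2.1 eq. (5)] -/
theorem Verjovsky2026_prop_2_1 {s : ℂ} (hs : 1 < s.re) :
    mellin (fun t ↦ ((moebiusLaplace t : ℝ) : ℂ)) s = Complex.Gamma s / riemannZeta s := by
  have hsum : Summable fun n : ℕ ↦ |((μ n : ℤ) : ℝ)| / (n : ℝ) ^ s.re := by
    refine Summable.of_nonneg_of_le (fun n ↦ by positivity) (fun n ↦ ?_)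
      ((Real.summable_one_div_nat_rpow.mpr hs))
    exact div_le_div_of_nonneg_right (abs_moebius_real_le_one n) (by positivity)
  have h := mellin_laplaceSeries (b := fun n ↦ ((μ n : ℤ) : ℝ)) moebius_zero_real
    (by linarith : 0 < s.re) hsum
  have hfun : (fun t ↦ ((moebiusLaplace t : ℝ) : ℂ)) =
      fun t ↦ ((laplaceSeries (fun n ↦ ((μ n : ℤ) : ℝ)) t : ℝ) : ℂ) := rfl
  rw [hfun, h, LSeries_moebius_real_eq hs, mul_one_div]

namespace MoebiusLaplace

/-! ## §3 Abel summation `Φ(t) = (1 − e^{−t}) Σ M(n) e^{−nt}` and the bound `|Φ(t)| ≪ t^{−α}` from `M(n) ≪ n^α` -/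

/-- `Σ_{k ≤ n} μ(k) = M(n)` (over `ℝ`). [folklore] -/
private theorem sum_range_succ_moebius_eq_mertensFunction (n : ℕ) :
    ∑ k ∈ range (n + 1), ((μ k : ℤ) : ℝ) = (mertensFunction (n : ℝ) : ℝ) := by
  induction n with
  | zero => simp [MertensDictionary.mertensFunction_zero]
  | succ n ih =>
    rw [Finset.sum_range_succ, ih, MertensDictionary.mertensFunction_succ]
    push_cast
    ring

/-- The Cauchy-product coefficient `Σ_{i+j=n} μ(i) · 1 = M(n)`. [folklore] -/
private theorem sum_antidiagonal_moebius_mul_one (n : ℕ) :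
    ∑ ij ∈ antidiagonal n, ((μ ij.1 : ℤ) : ℝ) * 1 = (mertensFunction (n : ℝ) : ℝ) := by
  rw [Nat.sum_antidiagonal_eq_sum_range_succ (fun i _ ↦ ((μ i : ℤ) : ℝ) * 1) n]
  simp only [mul_one]
  exact sum_range_succ_moebius_eq_mertensFunction n

/-- `|M(n)| ≤ n`. [folklore] -/
private theorem abs_mertensFunction_natCast_le (n : ℕ) : |(mertensFunction (n : ℝ) : ℝ)| ≤ n :=
  MertensDictionary.abs_mertensFunction_natCast_le n

/-- **Abel summation in series form** (the paper's (6) `Φ(t) = t ∫₁^∞ M(x) e^{−tx} dx` after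
evaluating `∫ₙ^{n+1} t e^{−tx} dx`): for `t > 0`, `Φ(t) = (1 − e^{−t}) Σ_n M(n) e^{−nt}` — the Cauchy
product of `Σ μ(n) e^{−nt}` with the geometric series `Σ e^{−nt} = (1 − e^{−t})^{−1}`.
[cite: Verjovsky2026, Thm. 3.1 proof, eq. (6)] -/
theorem moebiusLaplace_eq_mul_tsum {t : ℝ} (ht : 0 < t) :
    (Summable fun n : ℕ ↦ (mertensFunction (n : ℝ) : ℝ) * exp (-t * n)) ∧
    moebiusLaplace t =
      (1 - exp (-t)) * ∑' n : ℕ, (mertensFunction (n : ℝ) : ℝ) * exp (-t * n) := by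
  have hμ_s : Summable fun n : ℕ ↦ ‖((μ n : ℤ) : ℝ) * exp (-t * n)‖ :=
    summable_abs_mul_exp_of_le abs_moebius_real_le_one_mul ht
  have h1_s : Summable fun n : ℕ ↦ ‖(1 : ℝ) * exp (-t * n)‖ :=
    summable_abs_mul_exp_of_le (B := 1) (k := 0) (fun n ↦ by simp) ht
  have hM_s : Summable fun n : ℕ ↦ ‖(mertensFunction (n : ℝ) : ℝ) * exp (-t * n)‖ := by
    refine summable_abs_mul_exp_of_le (B := 1) (k := 1) (fun n ↦ ?_) ht
    rw [one_mul, pow_one]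
    exact (abs_mertensFunction_natCast_le n).trans (by linarith)
  have hprod := tsum_mul_exp_mul_tsum_mul_exp hμ_s h1_s
  have hgeom : ∑' n : ℕ, (1 : ℝ) * exp (-t * n) = (1 - exp (-t))⁻¹ := by
    simp_rw [one_mul, exp_neg_mul_natCast]
    exact tsum_geometric_of_lt_one (exp_pos _).le (exp_lt_one_iff.mpr (by linarith))
  have hanti : (fun n : ℕ ↦ (∑ ij ∈ antidiagonal n, ((μ ij.1 : ℤ) : ℝ) * 1) * exp (-t * n)) =
      fun n : ℕ ↦ (mertensFunction (n : ℝ) : ℝ) * exp (-t * n) := by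
    funext n; rw [sum_antidiagonal_moebius_mul_one]
  rw [hgeom, hanti] at hprod
  have hq : (1 - exp (-t)) ≠ 0 := by
    have := exp_lt_one_iff.mpr (show -t < 0 by linarith)
    linarith
  refine ⟨hM_s.of_norm, ?_⟩
  calc moebiusLaplace t = ∑' n : ℕ, ((μ n : ℤ) : ℝ) * exp (-t * n) := moebiusLaplace_eq_tsum t
    _ = ((∑' n : ℕ, ((μ n : ℤ) : ℝ) * exp (-t * n)) * (1 - exp (-t))⁻¹) * (1 - exp (-t)) := by
        field_simp
    _ = (1 - exp (-t)) * ∑' n : ℕ, (mertensFunction (n : ℝ) : ℝ) * exp (-t * n) := by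
        rw [hprod, mul_comm]

/-- `0 ≤ 1 − e^{−t} ≤ t` for `t ≥ 0`. [folklore] -/
private theorem one_sub_exp_neg_bounds {t : ℝ} (ht : 0 ≤ t) : 0 ≤ 1 - exp (-t) ∧ 1 - exp (-t) ≤ t := by
  constructor
  · have : exp (-t) ≤ 1 := exp_le_one_iff.mpr (by linarith)
    linarith
  · linarith [add_one_le_exp (-t)]

/-- **The bound behind "(i) ⟹ (ii)"**: if `|M(n)| ≤ C n^α` for all `n ≥ 1` (`C, α ≥ 0`), then for
`0 < t ≤ 1`, `|Φ(t)| ≤ C K(α) t^{−α}` — the series form of the paper's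
`|Φ(t)| ≤ t ∫₀^∞ x^{α} e^{−tx} dx · C = C Γ(α+1) t^{−α}`, with the tree's weighted geometric series
`Σ (n+1)^α e^{−tn} ≤ K(α) t^{−α−1}` in place of the `Γ`-integral and `1 − e^{−t} ≤ t`.
[cite: Verjovsky2026, Thm. 3.1 proof (estimate of Φ from (6))] -/
theorem abs_moebiusLaplace_le_of_mertens_le {C α : ℝ} (hC : 0 ≤ C) (hα : 0 ≤ α)
    (hM : ∀ n : ℕ, 1 ≤ n → |(mertensFunction (n : ℝ) : ℝ)| ≤ C * (n : ℝ) ^ α)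
    {t : ℝ} (ht : 0 < t) (ht1 : t ≤ 1) :
    |moebiusLaplace t| ≤ C * geomWeightConst α * t ^ (-α) := by
  obtain ⟨hS, hle⟩ := tsum_pow_succ_rpow_mul_exp_le hα ht ht1
  obtain ⟨-, hΦ⟩ := moebiusLaplace_eq_mul_tsum ht
  have hterm : ∀ n : ℕ, ‖(mertensFunction (n : ℝ) : ℝ) * exp (-t * n)‖ ≤
      C * (((n : ℝ) + 1) ^ α * exp (-t * n)) := by
    intro n
    rw [norm_mul, Real.norm_eq_abs, Real.norm_eq_abs, abs_of_pos (exp_pos _), ← mul_assoc]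
    refine mul_le_mul_of_nonneg_right ?_ (exp_pos _).le
    rcases Nat.eq_zero_or_pos n with rfl | hn
    · simp only [Nat.cast_zero, MertensDictionary.mertensFunction_zero, Int.cast_zero, abs_zero]
      positivity
    · refine (hM n hn).trans ?_
      gcongr
      linarith
  have hsum : Summable fun n : ℕ ↦ ‖(mertensFunction (n : ℝ) : ℝ) * exp (-t * n)‖ :=
    Summable.of_nonneg_of_le (fun n ↦ norm_nonneg _) hterm (hS.mul_left C)
  have h1 : |∑' n : ℕ, (mertensFunction (n : ℝ) : ℝ) * exp (-t * n)| ≤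
      C * (geomWeightConst α * t ^ (-(α + 1))) := by
    calc |∑' n : ℕ, (mertensFunction (n : ℝ) : ℝ) * exp (-t * n)|
        ≤ ∑' n : ℕ, ‖(mertensFunction (n : ℝ) : ℝ) * exp (-t * n)‖ := by
          rw [← Real.norm_eq_abs]; exact norm_tsum_le_tsum_norm hsum
      _ ≤ ∑' n : ℕ, C * (((n : ℝ) + 1) ^ α * exp (-t * n)) :=
          hsum.tsum_le_tsum hterm (hS.mul_left C)
      _ = C * ∑' n : ℕ, ((n : ℝ) + 1) ^ α * exp (-t * n) := tsum_mul_left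
      _ ≤ C * (geomWeightConst α * t ^ (-(α + 1))) := by gcongr
  obtain ⟨h0, h2⟩ := one_sub_exp_neg_bounds ht.le
  have hpow : t * t ^ (-(α + 1)) = t ^ (-α) := by
    rw [neg_add, rpow_add ht, rpow_neg_one]
    field_simp
  calc |moebiusLaplace t|
      = (1 - exp (-t)) * |∑' n : ℕ, (mertensFunction (n : ℝ) : ℝ) * exp (-t * n)| := by
        rw [hΦ, abs_mul, abs_of_nonneg h0]
    _ ≤ t * (C * (geomWeightConst α * t ^ (-(α + 1)))) :=
        mul_le_mul h2 h1 (abs_nonneg _) ht.le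
    _ = C * geomWeightConst α * (t * t ^ (-(α + 1))) := by ring
    _ = C * geomWeightConst α * t ^ (-α) := by rw [hpow]

/-- Under RH: `|Φ(t)| ≤ C t^{−1/2−δ}` on `(0, 1]` for every `δ > 0` (Littlewood's
`M(x) = O(x^{1/2+δ})`, tree `mertensFunction_isBigO_of_riemannHypothesis`, fed to the previous
bound). [cite: Verjovsky2026, Thm. 3.1 proof ("Assume RH. By (1) … = Γ(3/2+δ) t^{−1/2−δ}")] -/
theorem exists_abs_moebiusLaplace_le_rpow_of_riemannHypothesis (hRH : RiemannHypothesis)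
    {δ : ℝ} (hδ : 0 < δ) :
    ∃ C : ℝ, 0 ≤ C ∧ ∀ t : ℝ, 0 < t → t ≤ 1 → |moebiusLaplace t| ≤ C * t ^ (-(1 / 2 + δ)) := by
  have hO := mertensFunction_isBigO_of_riemannHypothesis hRH hδ
  obtain ⟨C, hC0, hC⟩ := MertensDictionary.exists_bound_of_isBigO (by positivity) hO
  refine ⟨C * geomWeightConst (1 / 2 + δ), mul_nonneg hC0 (geomWeightConst_nonneg _),
    fun t ht ht1 ↦ ?_⟩
  exact abs_moebiusLaplace_le_of_mertens_le hC0 (by positivity) hC ht ht1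

/-! ## §4 "(i) ⟹ (ii)": under RH, `Φ ∈ L^p(0,∞)` for `1 ≤ p < 2` -/

/-- `Φ ∈ L^p(0,∞)` (Mathlib `MemLp` for the restricted Lebesgue measure) iff `∫₀^∞ |Φ|^p < ∞`,
for `0 < p` (the two readings of condition (ii) of Thm. 3.1).
[cite: Verjovsky2026, Thm. 3.1 (ii) (Φ ∈ L^p(0,∞))] -/
theorem memLp_moebiusLaplace_iff {p : ℝ} (hp : 0 < p) :
    MemLp moebiusLaplace (ENNReal.ofReal p) (volume.restrict (Ioi 0)) ↔
      IntegrableOn (fun t ↦ |moebiusLaplace t| ^ p) (Ioi 0) := by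
  have h := integrable_norm_rpow_iff (f := moebiusLaplace) (p := ENNReal.ofReal p)
    aestronglyMeasurable_moebiusLaplace (by simpa using hp) ENNReal.ofReal_ne_top
  rw [ENNReal.toReal_ofReal hp.le] at h
  simp only [Real.norm_eq_abs] at h
  exact h.symm

/-- **"(i) ⟹ (ii)" of Thm. 3.1, integral form**: under RH, `∫₀^∞ |Φ(t)|^p dt < ∞` for every
`1 ≤ p < 2`: on `(0,1]` use `|Φ(t)| ≤ C t^{−1/2−δ}` with `δ = (2−p)/(4p)` (so `p(1/2+δ) < 1`), on
`[1,∞)` the exponential decay. [cite: Verjovsky2026, Thm. 3.1 proof ((i) ⟹ (ii))] -/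
theorem integrableOn_abs_moebiusLaplace_rpow_of_riemannHypothesis (hRH : RiemannHypothesis)
    {p : ℝ} (hp1 : 1 ≤ p) (hp2 : p < 2) :
    IntegrableOn (fun t ↦ |moebiusLaplace t| ^ p) (Ioi 0) := by
  have hp0 : 0 < p := by linarith
  set δ : ℝ := (2 - p) / (4 * p) with hδ
  have hδ0 : 0 < δ := by rw [hδ]; exact div_pos (by linarith) (by linarith)
  have hexp : -1 < -(1 / 2 + δ) * p := by
    have : (1 / 2 + δ) * p = (p + 2) / 4 := by rw [hδ]; field_simp; ring
    rw [neg_mul, this]; linarith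
  obtain ⟨C, hC0, hC⟩ := exists_abs_moebiusLaplace_le_rpow_of_riemannHypothesis hRH hδ0
  obtain ⟨C', hC'0, hC'⟩ := exists_abs_moebiusLaplace_le_exp_neg
  have hmeas : AEStronglyMeasurable (fun t ↦ |moebiusLaplace t| ^ p) (volume.restrict (Ioi 0)) :=
    ((continuousOn_moebiusLaplace.abs).rpow_const fun _ _ ↦ Or.inr hp0.le).aestronglyMeasurable
      measurableSet_Ioi
  rw [← Ioc_union_Ioi_eq_Ioi (zero_le_one : (0 : ℝ) ≤ 1)]
  refine IntegrableOn.union ?_ ?_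
  · -- `(0, 1]`
    have hmaj : IntegrableOn (fun t : ℝ ↦ C ^ p * t ^ (-(1 / 2 + δ) * p)) (Ioc 0 1) := by
      rw [integrableOn_Ioc_iff_integrableOn_Ioo]
      exact ((intervalIntegral.integrableOn_Ioo_rpow_iff one_pos).mpr hexp).const_mul _
    refine Integrable.mono' hmaj (hmeas.mono_measure (Measure.restrict_mono Set.Ioc_subset_Ioi_self
      le_rfl)) ?_
    refine ae_restrict_of_forall_mem measurableSet_Ioc fun t ht ↦ ?_
    rw [Real.norm_eq_abs, abs_of_nonneg (rpow_nonneg (abs_nonneg _) _)]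
    calc |moebiusLaplace t| ^ p ≤ (C * t ^ (-(1 / 2 + δ))) ^ p :=
          rpow_le_rpow (abs_nonneg _) (hC t ht.1 ht.2) hp0.le
      _ = C ^ p * t ^ (-(1 / 2 + δ) * p) := by
          rw [mul_rpow hC0 (rpow_nonneg ht.1.le _), ← rpow_mul ht.1.le]
  · -- `(1, ∞)`
    have hmaj : IntegrableOn (fun t : ℝ ↦ C' ^ p * exp (-p * t)) (Ioi 1) :=
      (exp_neg_integrableOn_Ioi 1 hp0).const_mul _
    refine Integrable.mono' hmaj (hmeas.mono_measure (Measure.restrict_mono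
      (Set.Ioi_subset_Ioi zero_le_one) le_rfl)) ?_
    refine ae_restrict_of_forall_mem measurableSet_Ioi fun t ht ↦ ?_
    have ht1 : (1 : ℝ) ≤ t := le_of_lt ht
    rw [Real.norm_eq_abs, abs_of_nonneg (rpow_nonneg (abs_nonneg _) _)]
    calc |moebiusLaplace t| ^ p ≤ (C' * exp (-t)) ^ p :=
          rpow_le_rpow (abs_nonneg _) (hC' t ht1) hp0.le
      _ = C' ^ p * exp (-p * t) := by
          rw [mul_rpow hC'0 (exp_pos _).le, ← Real.exp_mul]
          ring_nf

end MoebiusLaplace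

/-- **Verjovsky, Thm. 3.1, (i) ⟹ (ii)**: under RH, `Φ ∈ L^p(0,∞)` for every `1 ≤ p < 2`.
[cite: Verjovsky2026, Thm. 3.1 ((i) ⟹ (ii))] -/
theorem memLp_moebiusLaplace_of_riemannHypothesis (hRH : RiemannHypothesis) {p : ℝ}
    (hp1 : 1 ≤ p) (hp2 : p < 2) :
    MemLp moebiusLaplace (ENNReal.ofReal p) (volume.restrict (Ioi 0)) :=
  (memLp_moebiusLaplace_iff (by linarith)).mpr
    (integrableOn_abs_moebiusLaplace_rpow_of_riemannHypothesis hRH hp1 hp2)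

namespace MoebiusLaplace

/-! ## §5 The Mellin transform is holomorphic in its strip of absolute convergence (general `f`) -/

/-- Two-sided domination of the Mellin weight: for `σ₁ ≤ σ ≤ σ₂` and `t > 0`,
`t^{σ−1} ≤ t^{σ₁−1} + t^{σ₂−1}`. [folklore] -/
private theorem rpow_sub_one_le_add {t σ σ₁ σ₂ : ℝ} (ht : 0 < t) (h1 : σ₁ ≤ σ) (h2 : σ ≤ σ₂) :
    t ^ (σ - 1) ≤ t ^ (σ₁ - 1) + t ^ (σ₂ - 1) := by
  rcases le_or_gt 1 t with ht1 | ht1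
  · have : t ^ (σ - 1) ≤ t ^ (σ₂ - 1) := rpow_le_rpow_of_exponent_le ht1 (by linarith)
    linarith [rpow_nonneg ht.le (σ₁ - 1)]
  · have : t ^ (σ - 1) ≤ t ^ (σ₁ - 1) := rpow_le_rpow_of_exponent_ge ht ht1.le (by linarith)
    linarith [rpow_nonneg ht.le (σ₂ - 1)]

/-- `‖t^{s−1} • f(t)‖ = t^{Re s−1} ‖f(t)‖` for `t > 0`. [folklore] -/
private theorem norm_cpow_smul {f : ℝ → ℂ} {t : ℝ} (ht : 0 < t) (s : ℂ) :
    ‖(t : ℂ) ^ (s - 1) • f t‖ = t ^ (s.re - 1) * ‖f t‖ := by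
  rw [norm_smul, Complex.norm_cpow_eq_rpow_re_of_pos ht]
  simp

/-- **Holomorphy of the Mellin transform in its strip of absolute convergence**: if `f` is
a.e. strongly measurable on `(0,∞)` and `∫₀^∞ t^{σ−1} ‖f(t)‖ dt < ∞` for every `σ ∈ (a, b)`, then
`s ↦ ∫₀^∞ f(t) t^{s−1} dt` is holomorphic on `a < Re s < b` (dominated holomorphic parameter
integral with local majorant `(t^{σ₁−1} + t^{σ₂−1})‖f(t)‖`; the paper's footnote 1 argues via
Morera). Mathlib's `mellin_differentiableAt_of_isBigO_rpow` is the pointwise-`O` special case.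
[cite: Verjovsky2026, Prop. 2.2 proof, footnote 1 (holomorphy of MΦ on Re s > 1/p)] -/
theorem differentiableOn_mellin_of_integrableOn {f : ℝ → ℂ}
    (hf : AEStronglyMeasurable f (volume.restrict (Ioi 0))) {a b : ℝ}
    (hN : ∀ σ : ℝ, a < σ → σ < b → IntegrableOn (fun t : ℝ ↦ t ^ (σ - 1) * ‖f t‖) (Ioi 0)) :
    DifferentiableOn ℂ (mellin f) {s : ℂ | a < s.re ∧ s.re < b} := by
  have hcpow : ∀ s : ℂ, AEStronglyMeasurable (fun t : ℝ ↦ (t : ℂ) ^ (s - 1))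
      (volume.restrict (Ioi 0)) := fun s ↦
    ContinuousOn.aestronglyMeasurable (continuousOn_of_forall_continuousAt fun t ht ↦
      Complex.continuousAt_ofReal_cpow_const _ _ (Or.inr (ne_of_gt ht))) measurableSet_Ioi
  have hmeasF : ∀ s : ℂ, AEStronglyMeasurable (fun t : ℝ ↦ (t : ℂ) ^ (s - 1) • f t)
      (volume.restrict (Ioi 0)) := fun s ↦ (hcpow s).smul hf
  show DifferentiableOn ℂ (fun s : ℂ ↦ ∫ t in Ioi (0 : ℝ), (t : ℂ) ^ (s - 1) • f t)
    {s : ℂ | a < s.re ∧ s.re < b}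
  refine Literature.Analysis.Complex.differentiableOn_integral_of_dominated
    (F := fun (s : ℂ) (t : ℝ) ↦ (t : ℂ) ^ (s - 1) • f t) (fun s _ ↦ hmeasF s) ?_ ?_
  · refine ae_restrict_of_forall_mem measurableSet_Ioi fun t ht ↦ ?_
    have ht0 : (0 : ℝ) < t := ht
    have ht' : (t : ℂ) ≠ 0 := Complex.ofReal_ne_zero.2 ht0.ne'
    intro s _
    exact (((differentiableAt_id.sub_const 1).const_cpow (Or.inl ht')).smul_const
      (f t)).differentiableWithinAt
  · rintro s₀ ⟨ha, hb⟩
    set R : ℝ := min (s₀.re - a) (b - s₀.re) / 2 with hR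
    have hR0 : 0 < R := by
      rw [hR]; exact half_pos (lt_min (by linarith) (by linarith))
    have hRa : a < s₀.re - R := by
      have : R ≤ (s₀.re - a) / 2 := by
        rw [hR]; exact div_le_div_of_nonneg_right (min_le_left _ _) zero_le_two
      linarith
    have hRb : s₀.re + R < b := by
      have : R ≤ (b - s₀.re) / 2 := by
        rw [hR]; exact div_le_div_of_nonneg_right (min_le_right _ _) zero_le_two
      linarith
    have hre : ∀ s ∈ Metric.ball s₀ R, s₀.re - R < s.re ∧ s.re < s₀.re + R := by
      intro s hs
      rw [Metric.mem_ball, dist_eq_norm] at hs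
      have h1 : |(s - s₀).re| ≤ ‖s - s₀‖ := Complex.abs_re_le_norm _
      rw [Complex.sub_re] at h1
      constructor <;> linarith [(abs_lt.1 (h1.trans_lt hs)).1, (abs_lt.1 (h1.trans_lt hs)).2]
    refine ⟨R, hR0, fun s hs ↦ ⟨by linarith [(hre s hs).1], by linarith [(hre s hs).2]⟩,
      fun t ↦ (t ^ (s₀.re - R - 1) + t ^ (s₀.re + R - 1)) * ‖f t‖, ?_, ?_⟩
    · have h1 := hN _ hRa (by linarith)
      have h2 := hN _ (by linarith) hRb
      refine (h1.add h2).congr (ae_of_all _ fun t ↦ ?_)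
      simp only [Pi.add_apply]
      ring
    · refine ae_restrict_of_forall_mem measurableSet_Ioi fun t ht ↦ ?_
      intro s hs
      rw [norm_cpow_smul ht]
      exact mul_le_mul_of_nonneg_right
        (rpow_sub_one_le_add ht (hre s hs).1.le (hre s hs).2.le) (norm_nonneg _)

/-- Pointwise form: under the hypotheses of `differentiableOn_mellin_of_integrableOn` with
`b = +∞` (all `σ > a`), the Mellin transform is differentiable at every `s` with `Re s > a`.
[cite: Verjovsky2026, Prop. 2.2 proof, footnote 1 (holomorphy of MΦ on Re s > 1/p)] -/
theorem differentiableAt_mellin_of_integrableOn {f : ℝ → ℂ}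
    (hf : AEStronglyMeasurable f (volume.restrict (Ioi 0))) {a : ℝ}
    (hN : ∀ σ : ℝ, a < σ → IntegrableOn (fun t : ℝ ↦ t ^ (σ - 1) * ‖f t‖) (Ioi 0))
    {s : ℂ} (hs : a < s.re) :
    DifferentiableAt ℂ (mellin f) s := by
  have hU : IsOpen {z : ℂ | a < z.re ∧ z.re < s.re + 1} :=
    (isOpen_lt continuous_const Complex.continuous_re).inter
      (isOpen_lt Complex.continuous_re continuous_const)
  exact (differentiableOn_mellin_of_integrableOn hf (b := s.re + 1)
    (fun σ h1 _ ↦ hN σ h1)).differentiableAt (hU.mem_nhds ⟨hs, by simp⟩)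

/-! ## §6 "(ii) ⟹ (i)": Hölder (Young) from `L^p` to absolute convergence for `σ > 1/p`, holomorphy, and `Γ ≠ 0` -/

/-- **The Hölder step of Prop. 2.2, in Young's-inequality form**: if `1 < p`, `∫₀^∞ |Φ|^p < ∞` and
`σ > 1/p`, then `∫₀^∞ t^{σ−1}|Φ(t)| dt < ∞`. On `(0,1]`: `t^{σ−1}|Φ| ≤ |Φ|^p/p + t^{(σ−1)q}/q`
with `q = p/(p−1)`, and `(σ−1)q > −1 ⟺ σ > 1/p` (as printed: "`∫₀¹ |Φ|t^{σ−1} ≤ ‖Φ‖_p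
(∫₀¹ t^{(σ−1)p'})^{1/p'}`, finite precisely when `σ > 1/p`"); on `[1,∞)`: `|Φ(t)| ≤ C e^{−t}`.
[cite: Verjovsky2026, Prop. 2.2 proof (Hölder near zero, absolute convergence at infinity)] -/
theorem integrableOn_rpow_mul_norm_moebiusLaplace {p : ℝ} (hp : 1 < p)
    (hΦ : IntegrableOn (fun t ↦ |moebiusLaplace t| ^ p) (Ioi 0)) {σ : ℝ} (hσ : 1 / p < σ) :
    IntegrableOn (fun t : ℝ ↦ t ^ (σ - 1) * ‖((moebiusLaplace t : ℝ) : ℂ)‖) (Ioi 0) := by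
  have hp0 : 0 < p := by linarith
  have hp1 : 0 < p - 1 := by linarith
  have hσ0 : 0 < σ := lt_trans (div_pos one_pos hp0) hσ
  have hpq : p.HolderConjugate (p / (p - 1)) := Real.HolderConjugate.conjExponent hp
  set q : ℝ := p / (p - 1) with hq
  have hq0 : 0 < q := by rw [hq]; exact div_pos hp0 hp1
  have he1 : -1 < (σ - 1) * q := by
    have hσp : 1 < σ * p := by rwa [div_lt_iff₀ hp0] at hσ
    rw [hq, mul_div_assoc', lt_div_iff₀ hp1]
    nlinarith
  have hmeas : AEStronglyMeasurable (fun t : ℝ ↦ t ^ (σ - 1) * ‖((moebiusLaplace t : ℝ) : ℂ)‖)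
      (volume.restrict (Ioi 0)) := by
    refine (ContinuousOn.mul ?_ ?_).aestronglyMeasurable measurableSet_Ioi
    · exact ContinuousOn.rpow_const continuousOn_id fun t ht ↦ Or.inl (ne_of_gt ht)
    · exact (Complex.continuous_ofReal.comp_continuousOn continuousOn_moebiusLaplace).norm
  obtain ⟨C, hC0, hC⟩ := exists_abs_moebiusLaplace_le_exp_neg
  rw [← Ioc_union_Ioi_eq_Ioi (zero_le_one : (0 : ℝ) ≤ 1)]
  refine IntegrableOn.union ?_ ?_
  · -- `(0, 1]`: Young's inequality against the integrable majorant
    have hmaj2 : IntegrableOn (fun t : ℝ ↦ t ^ ((σ - 1) * q) / q) (Ioc 0 1) := by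
      rw [integrableOn_Ioc_iff_integrableOn_Ioo]
      exact ((intervalIntegral.integrableOn_Ioo_rpow_iff one_pos).mpr he1).div_const q
    have hmaj : IntegrableOn
        (fun t : ℝ ↦ |moebiusLaplace t| ^ p / p + t ^ ((σ - 1) * q) / q) (Ioc 0 1) :=
      ((hΦ.mono_set Set.Ioc_subset_Ioi_self).div_const p).add hmaj2
    refine Integrable.mono' hmaj (hmeas.mono_measure (Measure.restrict_mono Set.Ioc_subset_Ioi_self
      le_rfl)) ?_
    refine ae_restrict_of_forall_mem measurableSet_Ioc fun t ht ↦ ?_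
    have ht0 : 0 < t := ht.1
    rw [Real.norm_eq_abs, abs_mul, abs_of_nonneg (rpow_nonneg ht0.le _), abs_norm,
      Complex.norm_real, Real.norm_eq_abs]
    have hyoung := Real.young_inequality_of_nonneg (abs_nonneg (moebiusLaplace t))
      (rpow_nonneg ht0.le (σ - 1)) hpq
    rw [mul_comm]
    refine hyoung.trans (le_of_eq ?_)
    rw [← rpow_mul ht0.le]
  · -- `(1, ∞)`: exponential decay
    have hmaj : IntegrableOn (fun t : ℝ ↦ C * (exp (-t) * t ^ (σ - 1))) (Ioi 1) :=
      ((Real.GammaIntegral_convergent hσ0).mono_set (Set.Ioi_subset_Ioi zero_le_one)).const_mul C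
    refine Integrable.mono' hmaj (hmeas.mono_measure (Measure.restrict_mono
      (Set.Ioi_subset_Ioi zero_le_one) le_rfl)) ?_
    refine ae_restrict_of_forall_mem measurableSet_Ioi fun t ht ↦ ?_
    have ht1 : (1 : ℝ) ≤ t := le_of_lt ht
    have ht0 : 0 < t := lt_of_lt_of_le one_pos ht1
    rw [Real.norm_eq_abs, abs_mul, abs_of_nonneg (rpow_nonneg ht0.le _), abs_norm,
      Complex.norm_real, Real.norm_eq_abs]
    calc t ^ (σ - 1) * |moebiusLaplace t| ≤ t ^ (σ - 1) * (C * exp (-t)) :=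
          mul_le_mul_of_nonneg_left (hC t ht1) (rpow_nonneg ht0.le _)
      _ = C * (exp (-t) * t ^ (σ - 1)) := by ring

/-- `MΦ` is holomorphic on `Re s > 1/p` when `Φ ∈ L^p(0,∞)`, `1 < p`.
[cite: Verjovsky2026, Prop. 2.2 proof ("MΦ(s) is holomorphic in Re s > 1/p")] -/
theorem differentiableAt_mellin_moebiusLaplace {p : ℝ} (hp : 1 < p)
    (hΦ : IntegrableOn (fun t ↦ |moebiusLaplace t| ^ p) (Ioi 0)) {s : ℂ} (hs : 1 / p < s.re) :
    DifferentiableAt ℂ (mellin fun t ↦ ((moebiusLaplace t : ℝ) : ℂ)) s :=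
  differentiableAt_mellin_of_integrableOn aestronglyMeasurable_moebiusLaplace_complex
    (fun _ hσ ↦ integrableOn_rpow_mul_norm_moebiusLaplace hp hΦ hσ) hs

/-- **The continuation step of Prop. 2.2** (footnote 2 of the paper): if `MΦ` is holomorphic on
`Re s > θ` (`θ > 0`), then `ζ(s) ≠ 0` for `θ < Re s < 1`. With `F = MΦ · ζ − Γ`, holomorphic on
the slit half-plane `{Re s > θ} ∖ [1,∞)` (which avoids the pole of `ζ`) and `≡ 0` near `s = 2 + i`
by Prop. 2.1, the identity theorem gives `F ≡ 0`; at a zero `s₀` of `ζ` this reads `Γ(s₀) = 0`,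
impossible. [cite: Verjovsky2026, Prop. 2.2 proof, footnote 2] -/
theorem quasiRiemannHypothesis_of_differentiableAt_mellin {θ : ℝ} (hθ : 0 < θ)
    (hd : ∀ s : ℂ, θ < s.re → DifferentiableAt ℂ (mellin fun t ↦ ((moebiusLaplace t : ℝ) : ℂ)) s) :
    QuasiRiemannHypothesis θ := by
  rcases le_or_gt 1 θ with hθ1 | hθ1
  · exact quasiRiemannHypothesis_one.mono hθ1
  set M : ℂ → ℂ := mellin fun t ↦ ((moebiusLaplace t : ℝ) : ℂ) with hM
  intro s₀ hζ h1 h2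
  set U := VonKochConverse.slitHalfPlane θ with hU
  set F : ℂ → ℂ := fun s ↦ M s * riemannZeta s - Complex.Gamma s with hF
  have hU1 : ∀ s ∈ U, s ≠ 1 := fun s hs h ↦ VonKochConverse.one_notMem_slitHalfPlane θ (h ▸ hs)
  have hUre : ∀ s ∈ U, 0 < s.re := fun s hs ↦ hθ.trans hs.1
  have hΓd : ∀ s ∈ U, DifferentiableAt ℂ Complex.Gamma s := by
    intro s hs
    refine Complex.differentiableAt_Gamma s fun m hm ↦ ?_
    have := hUre s hs
    rw [hm] at this
    simp at this
    linarith [(m.cast_nonneg : (0 : ℝ) ≤ m)]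
  have hFan : AnalyticOnNhd ℂ F U := by
    refine DifferentiableOn.analyticOnNhd (fun s hs ↦ ?_) (VonKochConverse.isOpen_slitHalfPlane θ)
    have hζd : DifferentiableAt ℂ riemannZeta s := differentiableAt_riemannZeta (hU1 s hs)
    have hMs : DifferentiableAt ℂ M s := hd s hs.1
    have hΓ := hΓd s hs
    exact ((hMs.mul hζd).sub hΓ).differentiableWithinAt
  have hF0 : F =ᶠ[𝓝 (2 + Complex.I)] 0 := by
    have hopen : IsOpen {s : ℂ | 1 < s.re} := isOpen_lt continuous_const Complex.continuous_re
    filter_upwards [hopen.mem_nhds (by simp : (2 + Complex.I : ℂ) ∈ {s : ℂ | 1 < s.re})]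
      with s hs
    have hs : 1 < s.re := hs
    have hne := riemannZeta_ne_zero_of_one_lt_re hs
    have hid : M s = Complex.Gamma s / riemannZeta s := Verjovsky2026_prop_2_1 hs
    simp only [hF, Pi.zero_apply, hid]
    field_simp
    ring
  have h2I : (2 + Complex.I : ℂ) ∈ U := ⟨by simp; linarith, fun h ↦ by simp at h⟩
  have hFU : EqOn F 0 U :=
    hFan.eqOn_zero_of_preconnected_of_eventuallyEq_zero
      (VonKochConverse.isPreconnected_slitHalfPlane hθ1) h2I hF0
  have hs₀U : s₀ ∈ U := ⟨h1, fun _ ↦ h2⟩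
  have h0 := hFU hs₀U
  simp only [hF, Pi.zero_apply, hζ, mul_zero, zero_sub, neg_eq_zero] at h0
  exact Complex.Gamma_ne_zero_of_re_pos (hUre s₀ hs₀U) h0

/-- `Φ ∈ L^p(0,∞)` with `1 < p` (integral form) gives the quasi-Riemann hypothesis at `1/p`.
[cite: Verjovsky2026, Prop. 2.2] -/
theorem quasiRiemannHypothesis_of_integrableOn_rpow {p : ℝ} (hp : 1 < p)
    (hΦ : IntegrableOn (fun t ↦ |moebiusLaplace t| ^ p) (Ioi 0)) :
    QuasiRiemannHypothesis (1 / p) :=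
  quasiRiemannHypothesis_of_differentiableAt_mellin (div_pos one_pos (by linarith))
    fun _ hs ↦ differentiableAt_mellin_moebiusLaplace hp hΦ hs

end MoebiusLaplace

/-- **Verjovsky, Prop. 2.2** (= Remark 3.3: one exponent gives a zero-free half-plane): let
`1 < p < ∞`; if `Φ ∈ L^p(0,∞)` then `ζ(s) ≠ 0` throughout the half-plane `Re s > 1/p`. RH-FREE.
[cite: Verjovsky2026, Prop. 2.2 (and Remark 3.3)] -/
theorem Verjovsky2026_prop_2_2 {p : ℝ} (hp : 1 < p)
    (hΦ : MemLp moebiusLaplace (ENNReal.ofReal p) (volume.restrict (Ioi 0)))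
    {s : ℂ} (hs : 1 / p < s.re) : riemannZeta s ≠ 0 := by
  rcases le_or_gt 1 s.re with h1 | h1
  · exact riemannZeta_ne_zero_of_one_le_re h1
  · have hQ := quasiRiemannHypothesis_of_integrableOn_rpow hp
      ((memLp_moebiusLaplace_iff (by linarith)).mp hΦ)
    exact fun hζ ↦ hQ s hζ hs h1

/-- **Verjovsky, Thm. 3.1, (ii) ⟹ (i)**: if `Φ ∈ L^p(0,∞)` for every `1 ≤ p < 2` then RH (given
`σ > 1/2`, choose `p < 2` with `1/p < σ`; Prop. 2.2 clears `Re s > 1/2`; symmetry of the zeros).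
Only exponents `1 < p < 2` are used. [cite: Verjovsky2026, Thm. 3.1 ((ii) ⟹ (i))] -/
theorem riemannHypothesis_of_forall_memLp_moebiusLaplace
    (h : ∀ p : ℝ, 1 < p → p < 2 → MemLp moebiusLaplace (ENNReal.ofReal p) (volume.restrict (Ioi 0))) :
    RiemannHypothesis := by
  refine riemannHypothesis_of_forall_quasiRiemannHypothesis
    quasiRiemannHypothesis_one_half_iff_holds fun σ₀ hσ₀ ↦ ?_
  rcases le_or_gt 1 σ₀ with h1 | h1
  · exact quasiRiemannHypothesis_one.mono h1
  · -- `p` = midpoint of `1/σ₀` and `2`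
    have hσ0 : 0 < σ₀ := by linarith
    have hinv1 : 1 < 1 / σ₀ := by rw [lt_div_iff₀ hσ0]; linarith
    have hinv2 : 1 / σ₀ < 2 := by rw [div_lt_iff₀ hσ0]; linarith
    set p : ℝ := (1 / σ₀ + 2) / 2 with hp
    have hp1 : 1 < p := by rw [hp]; linarith
    have hp2 : p < 2 := by rw [hp]; linarith
    have hpσ : 1 / p ≤ σ₀ := by
      rw [div_le_iff₀ (by linarith), hp]
      have : σ₀ * (1 / σ₀) = 1 := by field_simp
      nlinarith
    exact (MoebiusLaplace.quasiRiemannHypothesis_of_integrableOn_rpow hp1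
      ((MoebiusLaplace.memLp_moebiusLaplace_iff (by linarith)).mp (h p hp1 hp2))).mono hpσ

/-- **Verjovsky, Thm. 3.1 ((i) ⟺ (ii))**: RH holds iff `Φ ∈ L^p(0,∞)` for every `1 ≤ p < 2`,
where `Φ(t) = Σ_{n≥1} μ(n) e^{−nt}`. RH-EQUIVALENT. [cite: Verjovsky2026, Thm. 3.1 ((i) ⟺ (ii))] -/
theorem Verjovsky2026_thm_3_1 :
    RiemannHypothesis ↔
      ∀ p : ℝ, 1 ≤ p → p < 2 → MemLp moebiusLaplace (ENNReal.ofReal p) (volume.restrict (Ioi 0)) :=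
  ⟨fun hRH _ hp1 hp2 ↦ memLp_moebiusLaplace_of_riemannHypothesis hRH hp1 hp2,
    fun h ↦ riemannHypothesis_of_forall_memLp_moebiusLaplace fun p hp1 hp2 ↦ h p hp1.le hp2⟩

/-- **Verjovsky, Thm. 3.1 ((i) ⟺ (iii))**: RH holds iff `Φ ∈ L^{2−ε}(0,∞)` for every
`0 < ε ≤ 1` ("only a change of notation" from (ii): `p = 2 − ε`). RH-EQUIVALENT.
[cite: Verjovsky2026, Thm. 3.1 ((i) ⟺ (iii))] -/
theorem Verjovsky2026_thm_3_1_iii :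
    RiemannHypothesis ↔
      ∀ ε : ℝ, 0 < ε → ε ≤ 1 →
        MemLp moebiusLaplace (ENNReal.ofReal (2 - ε)) (volume.restrict (Ioi 0)) := by
  rw [Verjovsky2026_thm_3_1]
  constructor
  · intro h ε hε0 hε1
    exact h (2 - ε) (by linarith) (by linarith)
  · intro h p hp1 hp2
    have := h (2 - p) (by linarith) (by linarith)
    rwa [show 2 - (2 - p) = p by ring] at this

/-- Integral form of Thm. 3.1: RH iff `∫₀^∞ |Φ(t)|^p dt < ∞` for every `1 ≤ p < 2`.
[cite: Verjovsky2026, Thm. 3.1] -/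
theorem riemannHypothesis_iff_forall_integrableOn_abs_moebiusLaplace_rpow :
    RiemannHypothesis ↔
      ∀ p : ℝ, 1 ≤ p → p < 2 → IntegrableOn (fun t ↦ |moebiusLaplace t| ^ p) (Ioi 0) := by
  rw [Verjovsky2026_thm_3_1]
  refine ⟨fun h p hp1 hp2 ↦ ?_, fun h p hp1 hp2 ↦ ?_⟩
  · exact (MoebiusLaplace.memLp_moebiusLaplace_iff (by linarith)).mp (h p hp1 hp2)
  · exact (MoebiusLaplace.memLp_moebiusLaplace_iff (by linarith)).mpr (h p hp1 hp2)

/-! ## §7 (appended) The pointwise Laplace–Mertens dictionary and Liflandsky's one-sided criterion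

S. Liflandsky, arXiv:2607.09797 (2026), **Thm. 1.3 (a)**: "if `Σ_{n≥1} μ(n) e^{−nx} = O(x^{−1/2})`
as `x → 0⁺`, then the Riemann hypothesis is true; no hypothesis on the zeros is required" —
Lemma 8.1 there (the bound makes `G(s) = ∫₀^∞ Φ(e^{−x}) x^{s−1} dx` holomorphic on `Re s > 1/2`)
and the identity theorem applied to `F = ζ G − Γ` on `{Re s > 1/2} ∖ {1}` (§8, Steps 1–6). The
argument is verbatim for any exponent `θ ∈ (0,1)` in place of `1/2` (`O(x^{−θ})` gives
`ζ ≠ 0` on `θ < Re s < 1`), which is how it is proved here, reusing §6's continuation step and the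
tree's `differentiableAt_mellin_laplaceSeries` (Mathlib `mellin_differentiableAt_of_isBigO_rpow_exp`).
Conversely, under RH `Φ(t) = O_ε(t^{−1/2−ε})` at `0⁺` (§3; Verjovsky's Remark 3.2: "the Mertens
bound on RH leads to the borderline scale `|Φ(t)| ≲ t^{−1/2−o(1)}`"). Liflandsky's Thm. 1.3 (b)
(the converse `O(x^{−1/2})` under RH + simple zeros + his Hypothesis (H)) and the explicit formula
Thm. 1.1 are NOT formalised. -/

namespace MoebiusLaplace

/-- **Pointwise Laplace–Mertens dictionary** (Liflandsky's Lemma 8.1 + proof of Thm. 1.3 (a), run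
with a general exponent): if `Φ(t) = O(t^{−θ})` as `t → 0⁺` with `0 < θ`, then `ζ(s) ≠ 0` for
`θ < Re s < 1`. [cite: Liflandsky2026, Lemma 8.1 and Thm. 1.3 (a) proof (§8, Steps 1–5; exponent 1/2 there)] -/
theorem quasiRiemannHypothesis_of_isBigO {θ : ℝ} (hθ : 0 < θ)
    (hO : moebiusLaplace =O[𝓝[>] 0] fun t : ℝ ↦ t ^ (-θ)) : QuasiRiemannHypothesis θ := by
  have hO' : (fun t ↦ ((laplaceSeries (fun n ↦ ((μ n : ℤ) : ℝ)) t : ℝ) : ℂ)) =O[𝓝[>] 0]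
      fun t : ℝ ↦ t ^ (-θ) :=
    (hO.norm_left.congr_left fun t ↦ (Complex.norm_real _).symm).of_norm_left
  refine quasiRiemannHypothesis_of_differentiableAt_mellin hθ fun s hs ↦ ?_
  have hfun : (fun t ↦ ((moebiusLaplace t : ℝ) : ℂ)) =
      fun t ↦ ((laplaceSeries (fun n ↦ ((μ n : ℤ) : ℝ)) t : ℝ) : ℂ) := rfl
  rw [hfun]
  exact differentiableAt_mellin_laplaceSeries moebius_zero_real abs_moebius_real_le_succ hO' hs

/-- Under RH, `Φ(t) = O_ε(t^{−1/2−ε})` as `t → 0⁺`, for every `ε > 0` (§3).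
[cite: Verjovsky2026, Remark 3.2 (and Thm. 3.1 proof: |Φ(t)| ≪ Γ(3/2+δ) t^{−1/2−δ})] -/
theorem isBigO_nhdsGT_zero_of_riemannHypothesis (hRH : RiemannHypothesis) {ε : ℝ} (hε : 0 < ε) :
    moebiusLaplace =O[𝓝[>] 0] fun t : ℝ ↦ t ^ (-(1 / 2 + ε)) := by
  obtain ⟨C, -, hC⟩ := exists_abs_moebiusLaplace_le_rpow_of_riemannHypothesis hRH hε
  refine IsBigO.of_bound C ?_
  filter_upwards [Ioc_mem_nhdsGT one_pos] with t ht
  rw [Real.norm_eq_abs, Real.norm_eq_abs, abs_of_pos (rpow_pos_of_pos ht.1 _)]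
  exact hC t ht.1 ht.2

end MoebiusLaplace

/-- **Liflandsky, Thm. 1.3 (a)**: if `Σ_{n≥1} μ(n) e^{−nx} = O(x^{−1/2})` as `x → 0⁺`, then the
Riemann hypothesis is true (no hypothesis on the zeros is required). RH-FREE implication
(hypothesis not asserted). [cite: Liflandsky2026, Thm. 1.3 (a)] -/
theorem Liflandsky2026_thm_1_3a
    (hO : moebiusLaplace =O[𝓝[>] 0] fun x : ℝ ↦ x ^ (-(1 / 2 : ℝ))) : RiemannHypothesis :=
  quasiRiemannHypothesis_one_half_iff_holds.mp
    (MoebiusLaplace.quasiRiemannHypothesis_of_isBigO one_half_pos hO)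

/-- The pointwise criterion assembled: RH iff `Φ(t) = O_ε(t^{−1/2−ε})` as `t → 0⁺` for every
`ε > 0` ("⟸": Liflandsky's argument at exponent `1/2 + ε`, then `riemannHypothesis_of_forall_quasiRiemannHypothesis`;
"⟹": Verjovsky's Remark 3.2). RH-EQUIVALENT.
[cite: Liflandsky2026, Thm. 1.3 (a) (proof, §8)] [cite: Verjovsky2026, Remark 3.2] -/
theorem riemannHypothesis_iff_moebiusLaplace_isBigO :
    RiemannHypothesis ↔
      ∀ ε : ℝ, 0 < ε → moebiusLaplace =O[𝓝[>] 0] fun t : ℝ ↦ t ^ (-(1 / 2 + ε)) := by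
  refine ⟨fun hRH ε hε ↦ MoebiusLaplace.isBigO_nhdsGT_zero_of_riemannHypothesis hRH hε,
    fun h ↦ ?_⟩
  refine riemannHypothesis_of_forall_quasiRiemannHypothesis
    quasiRiemannHypothesis_one_half_iff_holds fun σ₀ hσ₀ ↦ ?_
  have := h (σ₀ - 1 / 2) (by linarith)
  rw [show (1 / 2 + (σ₀ - 1 / 2)) = σ₀ by ring] at this
  exact MoebiusLaplace.quasiRiemannHypothesis_of_isBigO (by linarith) this

end Literature.NumberTheory.LFunctions

end
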